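import Summits.QuantumFields.BalabanUV.T4Continuum.Support.NE7ExactLiftGaugePart
import Summits.QuantumFields.BalabanUV.T4Continuum.Support.NE7OneLevelSliceStep
import HarnessLib

/-!
# NE7ExactLiftComposites — THE COMPOSITE LETTER (C) OF ROUTE (H′), IN KERNEL: for the exact one-step lift of record `r` (✓ `exactLift 2 N`, `d = 4`, `L = 2`, every `U(n)`-size `n`)
# and every `N`-periodic coarse 1-form `u`, **`√dirSq (r^{(m)} u) [0,2^mN)⁴ ≤ C̄ · ρ^m · √dirSq u [0,N)⁴`** with `ρ² = 3(17∕8)³∕4 = 7.197 < 8 = L³`, `C̄ = 4097·144·√(card n)`,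
# UNIFORM IN `m` AND `N` — the hypothesis shape of ✓ `NE7LevelMassBudgetGrowth.levelMassBudget_of_growth` (`2 ≤ ρ`, `ρ² < L³`)
# (lineage `b2b-balaban-t4-ne7b-p1`, gen 163; route (H′), memo `t4/b2b-balaban-t4-ne7b-p1/g162/records/SCOPING-LEVELMASSES.md` §8–§12 (R3e) = (C))

Cell `pub-balaban`, rung (B)+1 sub-cell t4, lineage `b2b-balaban-t4-ne7b-p1` (row NE7b OWNER + CRUX PROVER; junction service for row NE7 on ROAD-G116 §6 (G3) ∕ the ℓ² route to (G′)),
generation 163.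
WHY.  The root-form level-mass budget (✓ `NE7LevelMassBudget`, ✓ `…Growth`) of the hierarchical representative `X_i = r_i X_{i+1} + J_i` needs the composite-lift letters
`√dirSq (r_i∘⋯∘r_{k−1} u) ≤ C̄·ρ^{k−i}·√dirSq u` with `ρ² < L³`.  ✓ `NE7LiftMainPartMatrix.dirSq_TmatIter_le` gives them for the MAIN PART `T = W∘B_c⁻¹` with `ρ² = 7.197`; ✓ `NE7ExactLiftGaugePart`
gives `r = T − gaugeDir∘interp∘Θ∘B_c⁻¹`, the EXACT reproduction of gauge directions `r(gaugeDir σ) = gaugeDir(interp σ)`, and the letters.  THIS FILE runs the induction: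
`r^{(m)}u = T^{(m)}u − gaugeDir γ_m` with `γ_{m+1} = interp 2 univ (Θ B_c⁻¹ T^{(m)}u + γ_m)`, and `√dirSq(gaugeDir γ_{m+1}) ≤ 2·(1024·‖T^{(m)}u‖ + √dirSq(gaugeDir γ_m))` (W's SHARP constant
`L^{(d−2)∕2} = 2 < 2.6 ≤ ρ`): the gauge corrections are a convergent perturbation and the ratio stays `ρ`.
WHAT ([folklore]; DATA defs `liftIter`, `rho`, `Kmain`, `Dgauge`; 0 sorry; `d = 4`, `M = L = 2`):
§1 `liftIter N m` (the composite `r_{2^{m−1}N} ∘ ⋯ ∘ r_N`), `liftIter_periodic`; the ratio `rho = √(3(17∕8)³∕4)`: `rho_sq`, `rho_ge_26` (`≥ 2.6`), `two_le_rho`, `rho_sq_lt` (`< 8 = 2³`);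
§2 the letters in root form: `sqrt_dirSq_TmatIter_le` (`≤ Kmain·ρ^m·√dirSq u`, `Kmain = 144√(card n)`), `sqrt_dirSq_gaugeDir_theta_binv_le` (`≤ 1024·√dirSq v`), `sqrt_dirSq_gaugeDir_interp_le`
   (`≤ 2·√dirSq (gaugeDir η)` — W sharp on the gauge sector);
§3 **`liftIter_decomp`** (the induction: `∃ γ` periodic, `liftIter N m u = TmatIter N m u − gaugeDir 1 γ`, `√dirSq(gaugeDir γ) ≤ Dgauge·ρ^m·√dirSq u`, `Dgauge = 4096·Kmain`);
§4 **`sqrt_dirSq_liftIter_le`** — (C): `√dirSq (liftIter N m u) [0,2^mN)⁴ ≤ (Kmain + Dgauge)·ρ^m·√dirSq u [0,N)⁴`; squared form `dirSq_liftIter_le`; exactness of the iterate is ✓ `cpush_exactLift` levelwise.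
WHAT IS NOT HERE: the curved transport (R4: Neumann in the class, `O(a)` letters), the hierarchical gauge assembly (K), the final (G3) = ✓ p834121 ∘ budget — next.
HONEST FRAMING (page 1): elementary inequalities about OUR flat lift; constants crude (`C̄ ≈ 5.9·10⁵·√(card n)`); nothing of Bałaban's asserted ([Balaban1985Averaging] (42), (47)–(48) context only);
NOT (G3), NOT (G′), NOT NE7∕NE3 as spine nodes; row NE7b NOT PRINTED ∕ NOT PROVED; spine 0∕9; finite T⁴ rung (B)+1 — NOT infinite volume, NOT mass gap, NOT BetaPertH, NOT Clay.
-/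

set_option autoImplicit false

open scoped BigOperators Matrix Matrix.Norms.L2Operator
open Finset

namespace Summit.QuantumFields.BalabanUV.T4Continuum.NE7ExactLiftComposites

open Literature.MathematicalPhysics.QuantumFieldTheory.Balaban1983to89
open B7Prop1Explicit
open T4AveragingDeficitWall (dirSq)
open T4AveragingDeficitWallBoundary (periodBox)
open BlockAveragePushDirGauge (gaugeDir)
open MinimalActionWitness (flatCfg)
open SmoothRefineInterp (interp interpCore interpCore_add)
open NE3CoarseInterpolant (interp_add_period)
open NE3TangentFlatPush (flatCfg_eq_flat)
open NE3LiftDefectCorrection (sqrt_dirSq_add_le)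
open NE7OneLevelSliceStep (sqrt_dirSq_sub_le)
open NE3EnergyHessContTwoTerm (dirSq_nonneg)
open NE7WhitneyLiftFlat (dirSq_whitneyLift_le whitneyLift_gaugeDir_flat)
open NE7LiftMainPartMatrix (Tmat TmatIter TmatIter_periodic dirSq_TmatIter_le)
open NE7ExactLiftGaugePart (wlift binv theta exactLift exactLift_sub exactLift_periodic exactLift_gaugeDir exactLift_eq_main_sub_gauge wlift_binv_two gaugeDir_flatCfg_add gaugeDir_flatCfg_zero
  gaugeDir_flatCfg_periodic binv_periodic theta_periodic dirSq_gaugeDir_flatCfg_le sum_norm_sq_theta_le dirSq_binv_le inv_one_sub_two_c)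

noncomputable section

variable {n : Type*} [Fintype n] [DecidableEq n]

/-! ## §1 The composite lift and the ratio -/

/-- **THE COMPOSITE OF THE EXACT LIFTS OVER `m` LEVELS** (periods `N → 2N → ⋯ → 2^m N`): `liftIter N 0 = id`, `liftIter N (m+1) = exactLift 2 (2^m N) ∘ liftIter N m`. [folklore] -/
def liftIter (N : ℕ) : ℕ → (Site 4 → Fin 4 → Matrix n n ℂ) → (Site 4 → Fin 4 → Matrix n n ℂ)
  | 0, u => u
  | m + 1, u => exactLift 2 (2 ^ m * N) (liftIter N m u)

/-- The composite lift of an `N`-periodic 1-form over `m` levels is `2^m N`-periodic. [folklore] -/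
theorem liftIter_periodic (N : ℕ) {u : Site 4 → Fin 4 → Matrix n n ℂ} (hu : ∀ (y : Site 4) (j κ : Fin 4), u (y + (N : ℤ) • e j) κ = u y κ) :
    ∀ (m : ℕ) (y : Site 4) (j κ : Fin 4), liftIter N m u (y + ((2 ^ m * N : ℕ) : ℤ) • e j) κ = liftIter N m u y κ := by
  intro m
  induction m with
  | zero => intro y j κ; simpa [liftIter] using hu y j κ
  | succ m ih =>
      intro y j κ
      have h := exactLift_periodic (by norm_num : 1 ≤ 2) (2 ^ m * N) ih y j κ
      rw [show 2 * (2 ^ m * N) = 2 ^ (m + 1) * N by ring] at h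
      exact h

/-- **THE RATIO** `ρ = √(3(17∕8)³∕4) = 2.683`. [folklore] -/
def rho : ℝ := Real.sqrt (3 * (17 / 8 : ℝ) ^ 3 / 4)

/-- `ρ² = 3(17∕8)³∕4`. [folklore] -/
theorem rho_sq : rho ^ 2 = 3 * (17 / 8 : ℝ) ^ 3 / 4 := Real.sq_sqrt (by norm_num)

/-- `0 ≤ ρ`. [folklore] -/
theorem rho_nonneg : 0 ≤ rho := Real.sqrt_nonneg _

/-- `2.6 ≤ ρ` (`2.6² = 6.76 ≤ 7.197`). [folklore] -/
theorem rho_ge_26 : (26 / 10 : ℝ) ≤ rho := by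
  unfold rho
  rw [show (26 / 10 : ℝ) = Real.sqrt ((26 / 10) ^ 2) by rw [Real.sqrt_sq (by norm_num)]]
  exact Real.sqrt_le_sqrt (by norm_num)

/-- `2 ≤ ρ`. [folklore] -/
theorem two_le_rho : (2 : ℝ) ≤ rho := le_trans (by norm_num) rho_ge_26

/-- **`ρ² < 8 = L³`** at `L = 2`. [folklore] -/
theorem rho_sq_lt : rho ^ 2 < ((2 : ℕ) : ℝ) ^ 3 := by rw [rho_sq]; norm_num

/-- `ρ^{2m} = (ρ²)^m`. [folklore] -/
theorem rho_pow_two_mul (m : ℕ) : (3 * (17 / 8 : ℝ) ^ 3 / 4) ^ m = (rho ^ m) ^ 2 := by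
  rw [← rho_sq, ← pow_mul, ← pow_mul, mul_comm]

/-! ## §2 The letters in root form -/

/-- The main-part constant `Kmain = 12²·√(card n)`. [folklore] -/
def Kmain (n : Type*) [Fintype n] : ℝ := 144 * Real.sqrt (Fintype.card n)

omit [DecidableEq n] in
/-- `0 ≤ Kmain`. [folklore] -/
theorem Kmain_nonneg : 0 ≤ Kmain n := by unfold Kmain; positivity

/-- `√(a·b) ≤ √a·√b`-type helper: if `x ≤ c²·y` with `c ≥ 0` then `√x ≤ c·√y`. [folklore] -/
theorem sqrt_le_of_le_sq_mul {x y c : ℝ} (hc : 0 ≤ c) (h : x ≤ c ^ 2 * y) : Real.sqrt x ≤ c * Real.sqrt y := by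
  calc Real.sqrt x ≤ Real.sqrt (c ^ 2 * y) := Real.sqrt_le_sqrt h
    _ = c * Real.sqrt y := by rw [Real.sqrt_mul (sq_nonneg c), Real.sqrt_sq hc]

/-- **THE MAIN-PART LETTER IN ROOT FORM**: `√dirSq (TmatIter N m u) [0,2^mN)⁴ ≤ Kmain·ρ^m·√dirSq u [0,N)⁴` (`N ≥ 1`, `u` `N`-periodic). [folklore] -/
theorem sqrt_dirSq_TmatIter_le {N : ℕ} (hN : 1 ≤ N) {u : Site 4 → Fin 4 → Matrix n n ℂ} (hu : ∀ (y : Site 4) (j κ : Fin 4), u (y + (N : ℤ) • e j) κ = u y κ) (m : ℕ) :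
    Real.sqrt (dirSq (TmatIter N m u) (periodBox (d := 4) (2 ^ m * N))) ≤ Kmain n * rho ^ m * Real.sqrt (dirSq u (periodBox (d := 4) N)) := by
  have h := dirSq_TmatIter_le hN hu m
  rw [rho_pow_two_mul] at h
  refine sqrt_le_of_le_sq_mul (mul_nonneg Kmain_nonneg (pow_nonneg rho_nonneg m)) (h.trans (le_of_eq ?_))
  unfold Kmain
  rw [mul_pow, mul_pow, Real.sq_sqrt (Nat.cast_nonneg _)]
  ring

/-- **THE GAUGE-DATUM LETTER**: `√dirSq (gaugeDir 1 (theta 2 (binv 2 P v))) [0,P)⁴ ≤ 1024·√dirSq v [0,P)⁴` (`P ≥ 1`, `v` `P`-periodic; `1024 = √(4d)·√(d²2^d)·M^d`). [folklore] -/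
theorem sqrt_dirSq_gaugeDir_theta_binv_le {P : ℕ} (hP : 1 ≤ P) {v : Site 4 → Fin 4 → Matrix n n ℂ} (hv : ∀ (y : Site 4) (j κ : Fin 4), v (y + (P : ℤ) • e j) κ = v y κ) :
    Real.sqrt (dirSq (gaugeDir (flatCfg (d := 4) (n := n)) (theta 2 (binv 2 P v))) (periodBox (d := 4) P)) ≤ 1024 * Real.sqrt (dirSq v (periodBox (d := 4) P)) := by
  have hφ : ∀ (y : Site 4) (j κ : Fin 4), binv 2 P v (y + (P : ℤ) • e j) κ = binv 2 P v y κ := binv_periodic 2 P hv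
  have hθ : ∀ (y : Site 4) (j : Fin 4), theta 2 (binv 2 P v) (y + (P : ℤ) • e j) = theta 2 (binv 2 P v) y := theta_periodic (by norm_num) hφ
  have h1 := dirSq_gaugeDir_flatCfg_le (n := n) hP hθ
  have h2 := sum_norm_sq_theta_le (by norm_num : 1 ≤ 2) hP hφ
  have h3 := dirSq_binv_le (by norm_num : 1 ≤ 2) hP hv
  rw [inv_one_sub_two_c (by norm_num : 1 ≤ 2)] at h3
  refine sqrt_le_of_le_sq_mul (by norm_num) ?_
  have h0 : 0 ≤ dirSq v (periodBox (d := 4) P) := dirSq_nonneg _ _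
  calc dirSq (gaugeDir (flatCfg (d := 4) (n := n)) (theta 2 (binv 2 P v))) (periodBox (d := 4) P)
      ≤ 4 * (4 : ℕ) * ∑ y ∈ periodBox (d := 4) P, ‖theta 2 (binv 2 P v) y‖ ^ 2 := h1
    _ ≤ 4 * (4 : ℕ) * (((4 : ℕ) : ℝ) ^ 2 * 2 ^ 4 * dirSq (binv 2 P v) (periodBox (d := 4) P)) := mul_le_mul_of_nonneg_left h2 (by positivity)
    _ ≤ 4 * (4 : ℕ) * (((4 : ℕ) : ℝ) ^ 2 * 2 ^ 4 * ((((2 : ℕ) : ℝ) ^ 2) ^ 4 * dirSq v (periodBox (d := 4) P))) :=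
        mul_le_mul_of_nonneg_left (mul_le_mul_of_nonneg_left h3 (by positivity)) (by positivity)
    _ = (1024 : ℝ) ^ 2 * dirSq v (periodBox (d := 4) P) := by push_cast; ring

/-- **W IS SHARP ON THE GAUGE SECTOR**: `√dirSq (gaugeDir 1 (interp 2 univ η)) [0,2P)⁴ ≤ 2·√dirSq (gaugeDir 1 η) [0,P)⁴` (`P ≥ 1`, `η` `P`-periodic; `2 = √(M^d∕M²)`). [folklore] -/
theorem sqrt_dirSq_gaugeDir_interp_le {P : ℕ} (hP : 1 ≤ P) {η : Site 4 → Matrix n n ℂ} (hη : ∀ (y : Site 4) (j : Fin 4), η (y + (P : ℤ) • e j) = η y) :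
    Real.sqrt (dirSq (gaugeDir (flatCfg (d := 4) (n := n)) (interp 2 Finset.univ η)) (periodBox (d := 4) (2 * P)))
      ≤ 2 * Real.sqrt (dirSq (gaugeDir (flatCfg (d := 4) (n := n)) η) (periodBox (d := 4) P)) := by
  have hW : gaugeDir (flatCfg (d := 4) (n := n)) (interp 2 Finset.univ η) = wlift 2 (gaugeDir (flatCfg (d := 4) (n := n)) η) := by
    funext z κ'
    simp only [wlift, flatCfg_eq_flat]
    exact (whitneyLift_gaugeDir_flat (by norm_num : 1 ≤ 2) η z κ').symm
  have hper : ∀ (z : Site 4) (τ κ : Fin 4), gaugeDir (flatCfg (d := 4) (n := n)) η (z + (P : ℤ) • e τ) κ = gaugeDir (flatCfg (d := 4) (n := n)) η z κ :=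
    fun z τ κ => gaugeDir_flatCfg_periodic hη z τ κ
  have h := dirSq_whitneyLift_le (by norm_num : 1 ≤ 2) hP hper
  rw [hW]
  refine sqrt_le_of_le_sq_mul (by norm_num) (le_trans h (le_of_eq ?_))
  norm_num [wlift]

/-! ## §3 The induction: composite = main part − an exactly propagated gauge direction -/

/-- The gauge-part constant `Dgauge = 4096·Kmain`. [folklore] -/
def Dgauge (n : Type*) [Fintype n] : ℝ := 4096 * Kmain n

omit [DecidableEq n] in
/-- `0 ≤ Dgauge`. [folklore] -/
theorem Dgauge_nonneg : 0 ≤ Dgauge n := by unfold Dgauge; exact mul_nonneg (by norm_num) Kmain_nonneg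

omit [Fintype n] [DecidableEq n] in
/-- The interpolant is additive in the datum. [folklore] -/
theorem interp_add_fun (M : ℕ) (S : Finset (Fin 4)) (a b : Site 4 → Matrix n n ℂ) : interp M S (a + b) = interp M S a + interp M S b := by
  funext y
  exact interpCore_add S a b _ _

/-- **THE DECOMPOSITION OF THE COMPOSITE LIFT** (`N ≥ 1`, `u` `N`-periodic): for every `m` there is a `2^mN`-periodic potential `γ` with
`liftIter N m u = TmatIter N m u − gaugeDir 1 γ` and `√dirSq (gaugeDir 1 γ) [0,2^mN)⁴ ≤ Dgauge·ρ^m·√dirSq u [0,N)⁴`. [folklore] -/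
theorem liftIter_decomp {N : ℕ} (hN : 1 ≤ N) {u : Site 4 → Fin 4 → Matrix n n ℂ} (hu : ∀ (y : Site 4) (j κ : Fin 4), u (y + (N : ℤ) • e j) κ = u y κ) :
    ∀ m : ℕ, ∃ γ : Site 4 → Matrix n n ℂ,
      (∀ (y : Site 4) (j : Fin 4), γ (y + ((2 ^ m * N : ℕ) : ℤ) • e j) = γ y) ∧
      liftIter N m u = TmatIter N m u - gaugeDir (flatCfg (d := 4) (n := n)) γ ∧
      Real.sqrt (dirSq (gaugeDir (flatCfg (d := 4) (n := n)) γ) (periodBox (d := 4) (2 ^ m * N))) ≤ Dgauge n * rho ^ m * Real.sqrt (dirSq u (periodBox (d := 4) N)) := by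
  intro m
  induction m with
  | zero =>
      refine ⟨0, fun y j => rfl, ?_, ?_⟩
      · rw [gaugeDir_flatCfg_zero, sub_zero]; rfl
      · have hz : dirSq (gaugeDir (flatCfg (d := 4) (n := n)) (0 : Site 4 → Matrix n n ℂ)) (periodBox (d := 4) (2 ^ 0 * N)) = 0 := by
          rw [gaugeDir_flatCfg_zero]; simp [dirSq]
        rw [hz, Real.sqrt_zero]
        exact mul_nonneg (mul_nonneg Dgauge_nonneg (pow_nonneg rho_nonneg 0)) (Real.sqrt_nonneg _)
  | succ m ih =>
      obtain ⟨γ, hγP, hdec, hbd⟩ := ih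
      set P : ℕ := 2 ^ m * N with hPdef
      have hP : 1 ≤ P := Nat.mul_pos (Nat.two_pow_pos m) hN
      set v : Site 4 → Fin 4 → Matrix n n ℂ := TmatIter N m u with hv
      have hvP : ∀ (y : Site 4) (j κ : Fin 4), v (y + (P : ℤ) • e j) κ = v y κ := TmatIter_periodic N hu m
      set θ : Site 4 → Matrix n n ℂ := theta 2 (binv 2 P v) with hθ
      have hθP : ∀ (y : Site 4) (j : Fin 4), θ (y + (P : ℤ) • e j) = θ y := theta_periodic (by norm_num) (binv_periodic 2 P hvP)
      have hηP : ∀ (y : Site 4) (j : Fin 4), (θ + γ) (y + (P : ℤ) • e j) = (θ + γ) y := fun y j => by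
        simp only [Pi.add_apply, hθP, hγP]
      refine ⟨interp 2 Finset.univ (θ + γ), ?_, ?_, ?_⟩
      · -- periodicity `2P = 2^{m+1} N`
        intro y j
        rw [show 2 ^ (m + 1) * N = 2 * P by rw [hPdef]; ring]
        exact interp_add_period (by norm_num : 1 ≤ 2) Finset.univ hηP y j
      · -- the identity
        show exactLift 2 P (liftIter N m u) = Tmat P v - gaugeDir (flatCfg (d := 4) (n := n)) (interp 2 Finset.univ (θ + γ))
        rw [hdec, exactLift_sub, exactLift_eq_main_sub_gauge (by norm_num : 1 ≤ 2), exactLift_gaugeDir (by norm_num : 1 ≤ 2) hP hγP, interp_add_fun, gaugeDir_flatCfg_add]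
        have hT : wlift 2 (binv 2 P v) = Tmat P v := by
          funext z κ; rw [wlift_binv_two]; rfl
        rw [hT, ← hθ]
        abel
      · -- the bound
        have hstep := sqrt_dirSq_gaugeDir_interp_le (n := n) hP hηP
        rw [show 2 ^ (m + 1) * N = 2 * P by rw [hPdef]; ring]
        refine hstep.trans ?_
        rw [gaugeDir_flatCfg_add]
        have htri := sqrt_dirSq_add_le (gaugeDir (flatCfg (d := 4) (n := n)) θ) (gaugeDir (flatCfg (d := 4) (n := n)) γ) (periodBox (d := 4) P)
        have hθb := sqrt_dirSq_gaugeDir_theta_binv_le (n := n) hP hvP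
        have hvb := sqrt_dirSq_TmatIter_le hN hu m
        have hK := Kmain_nonneg (n := n)
        have hρm : 0 ≤ rho ^ m := pow_nonneg rho_nonneg m
        have hU := Real.sqrt_nonneg (dirSq u (periodBox (d := 4) N))
        have hρ := rho_ge_26
        calc 2 * Real.sqrt (dirSq (gaugeDir (flatCfg (d := 4) (n := n)) θ + gaugeDir (flatCfg (d := 4) (n := n)) γ) (periodBox (d := 4) P))
            ≤ 2 * (1024 * (Kmain n * rho ^ m * Real.sqrt (dirSq u (periodBox (d := 4) N))) + Dgauge n * rho ^ m * Real.sqrt (dirSq u (periodBox (d := 4) N))) := by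
              refine mul_le_mul_of_nonneg_left (htri.trans (add_le_add (hθb.trans ?_) hbd)) (by norm_num)
              exact mul_le_mul_of_nonneg_left hvb (by norm_num)
          _ = (10240 * Kmain n) * rho ^ m * Real.sqrt (dirSq u (periodBox (d := 4) N)) := by unfold Dgauge; ring
          _ ≤ (Dgauge n * rho) * rho ^ m * Real.sqrt (dirSq u (periodBox (d := 4) N)) := by
              refine mul_le_mul_of_nonneg_right (mul_le_mul_of_nonneg_right ?_ hρm) hU
              unfold Dgauge
              nlinarith [hK, hρ]
          _ = Dgauge n * rho ^ (m + 1) * Real.sqrt (dirSq u (periodBox (d := 4) N)) := by ring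

/-! ## §4 The composite letter (C) -/

/-- **(C) — THE COMPOSITES OF THE EXACT LIFT ARE BOUNDED WITH RATIO `ρ`, `ρ² = 7.197 < 8 = L³`** (`d = 4`, `L = 2`, `N ≥ 1`, `u` `N`-periodic, every `m`):
`√dirSq (liftIter N m u) [0,2^mN)⁴ ≤ (Kmain + Dgauge)·ρ^m·√dirSq u [0,N)⁴`. [folklore] -/
theorem sqrt_dirSq_liftIter_le {N : ℕ} (hN : 1 ≤ N) {u : Site 4 → Fin 4 → Matrix n n ℂ} (hu : ∀ (y : Site 4) (j κ : Fin 4), u (y + (N : ℤ) • e j) κ = u y κ) (m : ℕ) :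
    Real.sqrt (dirSq (liftIter N m u) (periodBox (d := 4) (2 ^ m * N))) ≤ (Kmain n + Dgauge n) * rho ^ m * Real.sqrt (dirSq u (periodBox (d := 4) N)) := by
  obtain ⟨γ, _, hdec, hbd⟩ := liftIter_decomp hN hu m
  rw [hdec]
  refine (sqrt_dirSq_sub_le _ _ _).trans ?_
  have h1 := sqrt_dirSq_TmatIter_le hN hu m
  calc Real.sqrt (dirSq (TmatIter N m u) (periodBox (d := 4) (2 ^ m * N))) + Real.sqrt (dirSq (gaugeDir (flatCfg (d := 4) (n := n)) γ) (periodBox (d := 4) (2 ^ m * N)))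
      ≤ Kmain n * rho ^ m * Real.sqrt (dirSq u (periodBox (d := 4) N)) + Dgauge n * rho ^ m * Real.sqrt (dirSq u (periodBox (d := 4) N)) := add_le_add h1 hbd
    _ = (Kmain n + Dgauge n) * rho ^ m * Real.sqrt (dirSq u (periodBox (d := 4) N)) := by ring

/-- **(C), SQUARED**: `dirSq (liftIter N m u) [0,2^mN)⁴ ≤ (Kmain + Dgauge)²·(ρ²)^m·dirSq u [0,N)⁴`. [folklore] -/
theorem dirSq_liftIter_le {N : ℕ} (hN : 1 ≤ N) {u : Site 4 → Fin 4 → Matrix n n ℂ} (hu : ∀ (y : Site 4) (j κ : Fin 4), u (y + (N : ℤ) • e j) κ = u y κ) (m : ℕ) :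
    dirSq (liftIter N m u) (periodBox (d := 4) (2 ^ m * N)) ≤ (Kmain n + Dgauge n) ^ 2 * (rho ^ 2) ^ m * dirSq u (periodBox (d := 4) N) := by
  have h := sqrt_dirSq_liftIter_le hN hu m
  have h0 : 0 ≤ dirSq (liftIter N m u) (periodBox (d := 4) (2 ^ m * N)) := dirSq_nonneg _ _
  have h0' : 0 ≤ dirSq u (periodBox (d := 4) N) := dirSq_nonneg _ _
  calc dirSq (liftIter N m u) (periodBox (d := 4) (2 ^ m * N)) = (Real.sqrt (dirSq (liftIter N m u) (periodBox (d := 4) (2 ^ m * N)))) ^ 2 := (Real.sq_sqrt h0).symm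
    _ ≤ ((Kmain n + Dgauge n) * rho ^ m * Real.sqrt (dirSq u (periodBox (d := 4) N))) ^ 2 := pow_le_pow_left₀ (Real.sqrt_nonneg _) h 2
    _ = (Kmain n + Dgauge n) ^ 2 * (rho ^ 2) ^ m * dirSq u (periodBox (d := 4) N) := by
        rw [mul_pow, mul_pow, Real.sq_sqrt h0', ← pow_mul, ← pow_mul, mul_comm m 2]

/-- **EXACTNESS OF THE COMPOSITE, LEVEL BY LEVEL**: `cpush 2 1 (liftIter N (m+1) u) = liftIter N m u` (`N ≥ 1`, `u` `N`-periodic). [folklore] -/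
theorem cpush_liftIter_succ {N : ℕ} (hN : 1 ≤ N) {u : Site 4 → Fin 4 → Matrix n n ℂ} (hu : ∀ (y : Site 4) (j κ : Fin 4), u (y + (N : ℤ) • e j) κ = u y κ) (m : ℕ) :
    AveragingDeficitMultiLevelPrep.cpush 2 (flatCfg (d := 4) (n := n)) (liftIter N (m + 1) u) = liftIter N m u := by
  show AveragingDeficitMultiLevelPrep.cpush 2 (flatCfg (d := 4) (n := n)) (exactLift 2 (2 ^ m * N) (liftIter N m u)) = liftIter N m u
  exact NE7ExactLiftGaugePart.cpush_exactLift (by norm_num) (Nat.mul_pos (Nat.two_pow_pos m) hN) (liftIter_periodic N hu m)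

end

end Summit.QuantumFields.BalabanUV.T4Continuum.NE7ExactLiftComposites
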